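import Literature.Analysis.FluidPDE.AncientSimilarityVariables
import Literature.Analysis.FluidPDE.ClassicalLocalEnergyCutoff
import Literature.Analysis.FluidPDE.WholeSpaceIBPEnstrophy
import HarnessLib

/-!
# The local energy identity of the backward (time-dependent) Leray system against a spatial
# cut-off, and its time-periodic (discretely self-similar) form

Analysis/FluidPDE proofs file (theorems only; no definitions, no named facts, no `sorry`).

In the backward similarity variables `U(s,y) = √(−t) u(t, √(−t) y)`, `s = −log(−t)`
(`AncientSimilarityVariables.lean`; Chae–Wolf 2017, §4), an ancient Navier–Stokes solution becomes a
classical solution of the **backward Leray system**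
`∂ₛU + ½U + ½(y·∇)U + (U·∇)U + ∇P = νΔU`, `div U = 0` (`IsBackwardLeraySolutionOn S ν U P`, by
definition the tree's classical Navier–Stokes notion with Leray's drift force
`f = −½(U + (y·∇)U)`), and a `λ`-DSS solution becomes an `L = 2 log λ`-periodic one. Multiplying by
`φU` for a time-independent cut-off `φ ∈ C_c^∞(E)` and integrating by parts (Leray 1934, (3.4);
Caffarelli–Kohn–Nirenberg 1982, (2.5); Chae–Wolf 2017, (2.4f)) gives, in dimension `d`,

  `d/ds ∫ φ|U|² + 2ν ∫ φ|∇U|² = ∫ (νΔφ + (d/2 − 1)φ + ½ y·∇φ)|U|² + ∫ (Dφ(U)|U|² + 2P Dφ(U))`: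

the drift contributes `2∫φ⟪f, U⟫ = (d/2 − 1)∫φ|U|² + ½∫(y·∇φ)|U|²`
(`2∫φ⟪(y·∇)U, U⟫ = −∫(y·∇φ)|U|² − d∫φ|U|²`, the tree's
`two_mul_integral_mul_inner_fderiv_self_self_eq`). In `d = 3` the zeroth-order coefficient is
`+½`: the similarity scaling FEEDS energy into every fixed region (anti-damping), which is what
allows nontrivial steady / periodic profiles to be consistent with the energy balance at all.

* `IsBackwardLeraySolutionOn.integral_drift_pairing` — the drift pairing above (slice);
* `IsBackwardLeraySolutionOn.integral_energy_flux_cutoff` — the slice balance;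
* `IsBackwardLeraySolutionOn.local_energy_identity_cutoff` — the identity integrated over
  `[s₀, s₁] ⊆ S` (`S` open);
* `IsBackwardLeraySolutionOn.period_energy_identity_cutoff` — **for an `L`-periodic solution on
  `S = univ` (the profile of a `λ`-DSS ancient solution, `L = 2 log λ`) the boundary terms cancel:**
  `2ν ∫_{s₀}^{s₀+L} ∫ φ|∇U|² = ∫_{s₀}^{s₀+L} [ ∫ (νΔφ + (d/2−1)φ + ½ y·∇φ)|U|² + ∫ (Dφ(U)|U|² + 2P Dφ(U)) ]`
  — the dissipation of a DSS profile over a period in any fixed region is paid for exactly by the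
  scaling source, the diffusive flux and the cubic/pressure flux through the cut-off.

Consumer: crux `FiniteDissipationLiouville` (route LerayQuarterDissipation), portrait of the DSS
wall (Bradshaw–Tsai OP 5.1): energy bookkeeping of a putative Type-I DSS blow-up profile.

## References

* J. Leray, Acta Math. 63 (1934), (3.11)–(3.12), §17 (3.4). [Leray1934]
* D. Chae, J. Wolf, arXiv:1610.09464, §2 (2.4f) and §4 (similarity variables, periodicity).
  [ChaeWolf2017RemovingDSS]
* L. Caffarelli, R. Kohn, L. Nirenberg, CPAM 35 (1982), §2 (2.5). [CaffarelliKohnNirenberg1982]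
-/

noncomputable section

open MeasureTheory TopologicalSpace Set Function Filter Metric
open _root_.Topology
open scoped Laplacian InnerProductSpace RealInnerProductSpace ENNReal NNReal ContDiff

namespace Literature.Analysis.FluidPDE

variable {E : Type*} [NormedAddCommGroup E] [InnerProductSpace ℝ E] [FiniteDimensional ℝ E]
  [MeasurableSpace E] [BorelSpace E]

variable {S : Set ℝ} {ν : ℝ} {U : ℝ → E → E} {P : ℝ → E → ℝ}

/-! ### The drift pairing -/

/-- **The pairing of Leray's drift force with `φU`**: for a classical solution of the backward
Leray system, `t ∈ S` and `φ ∈ C_c^∞`,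
`∫ 2φ⟪f, U⟫ = (d/2 − 1) ∫ φ|U|² + ½ ∫ (y·∇φ)|U|²`, `f = −½(U + (y·∇)U)`, `d = dim E`
(transport identity `2∫φ⟪(y·∇)U, U⟫ = −∫(y·∇φ)|U|² − d∫φ|U|²`). [cite: Leray1934, §17 (3.4)] -/
theorem IsBackwardLeraySolutionOn.integral_drift_pairing (h : IsBackwardLeraySolutionOn S ν U P)
    {φ : E → ℝ} (hφ : ContDiff ℝ ∞ φ) (hφc : HasCompactSupport φ) {t : ℝ} (ht : t ∈ S) :
    ∫ x, 2 * (φ x * ⟪rescaledEulerLerayForce 1 U t x, U t x⟫) =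
      ((Module.finrank ℝ E : ℝ) / 2 - 1) * (∫ x, φ x * ‖U t x‖ ^ 2) +
        (1 / 2) * ∫ x, fderiv ℝ φ x x * ‖U t x‖ ^ 2 := by
  have hU : ContDiff ℝ ∞ (U t) := h.contDiff_velocity ht
  have hU1 : ContDiff ℝ 1 (U t) := hU.of_le (by norm_cast)
  have hφ1 : ContDiff ℝ 1 φ := hφ.of_le (by norm_cast)
  have hcU : Continuous (U t) := hU.continuous
  have hcDU : Continuous (fderiv ℝ (U t)) := hU1.continuous_fderiv one_ne_zero
  have hcφ : Continuous φ := hφ.continuous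
  -- pointwise: `2φ⟪f, U⟫ = −φ|U|² − φ⟪DU(y), U⟫`
  have hpt : ∀ x, 2 * (φ x * ⟪rescaledEulerLerayForce 1 U t x, U t x⟫) =
      -(φ x * ‖U t x‖ ^ 2) - φ x * ⟪fderiv ℝ (U t) x x, U t x⟫ := by
    intro x
    rw [rescaledEulerLerayForce_apply, inner_neg_left, inner_smul_left, inner_add_left,
      real_inner_self_eq_norm_sq]
    simp only [RCLike.conj_to_real]
    ring
  have i1 : Integrable (fun x => φ x * ‖U t x‖ ^ 2) (volume : Measure E) :=
    (hcφ.mul (hcU.norm.pow 2)).integrable_of_hasCompactSupport hφc.mul_right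
  have i2 : Integrable (fun x => φ x * ⟪fderiv ℝ (U t) x x, U t x⟫) (volume : Measure E) :=
    (hcφ.mul ((hcDU.clm_apply continuous_id).inner hcU)).integrable_of_hasCompactSupport
      hφc.mul_right
  have hdrift := two_mul_integral_mul_inner_fderiv_self_self_eq (F' := E) hφ hφc hU
  have i1n : Integrable (fun x => -(φ x * ‖U t x‖ ^ 2)) (volume : Measure E) := i1.neg
  have hsplit : ∫ x, (-(φ x * ‖U t x‖ ^ 2) - φ x * ⟪fderiv ℝ (U t) x x, U t x⟫) =
      -(∫ x, φ x * ‖U t x‖ ^ 2) - ∫ x, φ x * ⟪fderiv ℝ (U t) x x, U t x⟫ := by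
    rw [integral_sub i1n i2, integral_neg]
  rw [integral_congr_ae (Eventually.of_forall hpt), hsplit]
  linarith

/-! ### The slice balance -/

/-- **The local energy balance of the backward Leray system at a fixed time** (Leray's (3.4) /
CKN (2.5) with equality, in similarity variables): for `t ∈ S` (`S` open) and `φ ∈ C_c^∞`,
`∫ (νΔφ|U|² + Dφ(U)|U|² + 2P Dφ(U)) + ((d/2 − 1)∫φ|U|² + ½∫(y·∇φ)|U|²) = ∫ 2φ⟪U, ∂ₛU⟫ + 2ν∫φ|∇U|²`.
[cite: ChaeWolf2017RemovingDSS, §4 with §2 (2.4f)] -/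
theorem IsBackwardLeraySolutionOn.integral_energy_flux_cutoff (h : IsBackwardLeraySolutionOn S ν U P)
    (hS : IsOpen S) {φ : E → ℝ} (hφ : ContDiff ℝ ∞ φ) (hφc : HasCompactSupport φ) {t : ℝ}
    (ht : t ∈ S) :
    (∫ x, (ν * ((Δ φ) x * ‖U t x‖ ^ 2) + fderiv ℝ φ x (U t x) * ‖U t x‖ ^ 2 +
        2 * (P t x * fderiv ℝ φ x (U t x)))) +
      (((Module.finrank ℝ E : ℝ) / 2 - 1) * (∫ x, φ x * ‖U t x‖ ^ 2) +
        (1 / 2) * ∫ x, fderiv ℝ φ x x * ‖U t x‖ ^ 2) =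
      (∫ x, φ x * (2 * ⟪U t x, timeDerivWithin S U t x⟫)) +
        2 * ν * ∫ x, frobeniusNormSq (fderiv ℝ (U t) x) * φ x := by
  have hU : ContDiff ℝ ∞ (U t) := h.contDiff_velocity ht
  have hU2 : ContDiff ℝ 2 (U t) := hU.of_le (by norm_cast)
  have hU1 : ContDiff ℝ 1 (U t) := hU.of_le (by norm_cast)
  have hP1 : ContDiff ℝ 1 (P t) := (h.contDiff_pressure ht).of_le (by norm_cast)
  have hdt : Continuous (timeDerivWithin S U t) :=
    ((h.smooth_velocity.timeDerivWithin hS.uniqueDiffOn).contDiff_slice ht).continuous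
  have hφ2 : ContDiff ℝ 2 φ := hφ.of_le (by norm_cast)
  have hφ1 : ContDiff ℝ 1 φ := hφ.of_le (by norm_cast)
  have hcU : Continuous (U t) := hU.continuous
  have hcDU : Continuous (fderiv ℝ (U t)) := hU1.continuous_fderiv one_ne_zero
  have hcP : Continuous (P t) := hP1.continuous
  have hcφ : Continuous φ := hφ.continuous
  have hcDφ : Continuous (fderiv ℝ φ) := hφ1.continuous_fderiv one_ne_zero
  have hcΔφ : Continuous (Δ φ) := FluidPDE.continuous_laplacian hφ2
  -- the slice of the drift force is continuous
  have hf : Continuous (rescaledEulerLerayForce 1 U t) := by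
    have e : rescaledEulerLerayForce 1 U t =
        fun x => -(((1 : ℝ) / 2) • (U t x + fderiv ℝ (U t) x x)) := by
      funext x; rw [rescaledEulerLerayForce_apply]
    rw [e]
    exact ((hcU.add (hcDU.clm_apply continuous_id)).const_smul _).neg
  have key := integral_energy_flux_eq_of_momentum (f := rescaledEulerLerayForce 1 U t) hU2 hP1 hdt
    hf (fun x => h.momentum t ht x) (h.divFree t ht) hφ2 hφc
  -- split off the drift pairing
  have hcDφs : HasCompactSupport (fderiv ℝ φ) := hφc.fderiv (𝕜 := ℝ)
  have hcΔφs : HasCompactSupport (Δ φ) :=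
    HasCompactSupport.intro hφc fun x hx => FluidPDE.laplacian_eq_zero_of_notMem_tsupport hx
  have iA : Integrable (fun x => ν * ((Δ φ) x * ‖U t x‖ ^ 2) + fderiv ℝ φ x (U t x) * ‖U t x‖ ^ 2 +
      2 * (P t x * fderiv ℝ φ x (U t x))) (volume : Measure E) := by
    refine Integrable.add (Integrable.add ?_ ?_) ?_
    · exact ((hcΔφ.mul (hcU.norm.pow 2)).integrable_of_hasCompactSupport hcΔφs.mul_right).const_mul ν
    · exact ((hcDφ.clm_apply hcU).mul (hcU.norm.pow 2)).integrable_of_hasCompactSupport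
        ((hcDφs.mono fun x hx => by contrapose! hx; simp_all).mul_right)
    · exact ((hcP.mul (hcDφ.clm_apply hcU)).integrable_of_hasCompactSupport
        ((hcDφs.mono fun x hx => by contrapose! hx; simp_all).mul_left)).const_mul 2
  have iF : Integrable (fun x => 2 * (φ x * ⟪rescaledEulerLerayForce 1 U t x, U t x⟫))
      (volume : Measure E) :=
    ((hcφ.mul (hf.inner hcU)).integrable_of_hasCompactSupport hφc.mul_right).const_mul 2
  rw [integral_add iA iF, h.integral_drift_pairing hφ hφc ht] at key
  exact key

/-- The drift term `s ↦ (d/2 − 1)∫φ|U(s)|² + ½∫(y·∇φ)|U(s)|²` is continuous on `S` (private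
plumbing for the time integration). [folklore] -/
private theorem IsBackwardLeraySolutionOn.continuousOn_integral_drift_cutoff
    (h : IsBackwardLeraySolutionOn S ν U P) {φ : E → ℝ} (hφ : ContDiff ℝ ∞ φ)
    (hφc : HasCompactSupport φ) :
    ContinuousOn (fun s => ((Module.finrank ℝ E : ℝ) / 2 - 1) * (∫ x, φ x * ‖U s x‖ ^ 2) +
      (1 / 2) * ∫ x, fderiv ℝ φ x x * ‖U s x‖ ^ 2) S := by
  have hφ1 : ContDiff ℝ 1 φ := hφ.of_le (by norm_cast)
  have hcφ : Continuous φ := hφ.continuous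
  have hcDφ : Continuous (fderiv ℝ φ) := hφ1.continuous_fderiv one_ne_zero
  have cu := h.smooth_velocity.continuousOn
  have c3 : ContinuousOn (fun z : ℝ × E => ‖U z.1 z.2‖ ^ 2) (S ×ˢ univ) := cu.norm.pow 2
  have h1 : ContinuousOn (fun s => ∫ x, φ x * ‖U s x‖ ^ 2) S := by
    refine continuousOn_integral_of_support_subset (μ := volume) (K := tsupport φ) hφc ?_ ?_
    · exact ((hcφ.comp continuous_snd).continuousOn).mul c3
    · intro s _ x hx
      show φ x * ‖U s x‖ ^ 2 = 0
      rw [image_eq_zero_of_notMem_tsupport hx, zero_mul]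
  have h2 : ContinuousOn (fun s => ∫ x, fderiv ℝ φ x x * ‖U s x‖ ^ 2) S := by
    refine continuousOn_integral_of_support_subset (μ := volume) (K := tsupport φ) hφc ?_ ?_
    · exact (((hcDφ.comp continuous_snd).clm_apply continuous_snd).continuousOn).mul c3
    · intro s _ x hx
      show fderiv ℝ φ x x * ‖U s x‖ ^ 2 = 0
      rw [fderiv_of_notMem_tsupport ℝ hx]
      simp
  exact (continuousOn_const.mul h1).add (continuousOn_const.mul h2)

/-! ### The integrated identity -/

/-- **The local energy identity of the backward Leray system, integrated in time**: for a
classical solution on an open time set `S`, `φ ∈ C_c^∞`, and `s₀ ≤ s₁` with `[s₀, s₁] ⊆ S`,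
`∫φ|U(s₁)|² − ∫φ|U(s₀)|² + 2ν∫_{s₀}^{s₁}∫φ|∇U|² = ∫_{s₀}^{s₁} [∫(νΔφ|U|² + Dφ(U)|U|² + 2PDφ(U)) + ((d/2−1)∫φ|U|² + ½∫(y·∇φ)|U|²)]`.
[cite: ChaeWolf2017RemovingDSS, §4 with §2 (2.4f)] [cite: Leray1934, §17 (3.4)] -/
theorem IsBackwardLeraySolutionOn.local_energy_identity_cutoff
    (h : IsBackwardLeraySolutionOn S ν U P) (hS : IsOpen S) {φ : E → ℝ} (hφ : ContDiff ℝ ∞ φ)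
    (hφc : HasCompactSupport φ) {s₀ s₁ : ℝ} (hs : s₀ ≤ s₁) (hI : Icc s₀ s₁ ⊆ S) :
    (∫ x, φ x * ‖U s₁ x‖ ^ 2) - (∫ x, φ x * ‖U s₀ x‖ ^ 2) +
        2 * ν * ∫ s in s₀..s₁, ∫ x, frobeniusNormSq (fderiv ℝ (U s) x) * φ x =
      ∫ s in s₀..s₁, ((∫ x, (ν * ((Δ φ) x * ‖U s x‖ ^ 2) +
        fderiv ℝ φ x (U s x) * ‖U s x‖ ^ 2 + 2 * (P s x * fderiv ℝ φ x (U s x)))) +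
        (((Module.finrank ℝ E : ℝ) / 2 - 1) * (∫ x, φ x * ‖U s x‖ ^ 2) +
          (1 / 2) * ∫ x, fderiv ℝ φ x x * ‖U s x‖ ^ 2)) := by
  have hφcont : Continuous φ := hφ.continuous
  have cT := h.continuousOn_integral_cutoff_inner_timeDeriv hS hφcont hφc
  have cF := h.continuousOn_integral_flux_cutoff hφ hφc
  have cD := h.continuousOn_integral_drift_cutoff hφ hφc
  have cG := h.continuousOn_integral_dissipation_cutoff hS hφcont hφc
  have hI' : uIcc s₀ s₁ ⊆ S := by rwa [uIcc_of_le hs]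
  have iT : IntervalIntegrable (fun s => ∫ x, φ x * (2 * ⟪U s x, timeDerivWithin S U s x⟫))
      volume s₀ s₁ := (cT.mono hI').intervalIntegrable
  have iF : IntervalIntegrable (fun s => (∫ x, (ν * ((Δ φ) x * ‖U s x‖ ^ 2) +
      fderiv ℝ φ x (U s x) * ‖U s x‖ ^ 2 + 2 * (P s x * fderiv ℝ φ x (U s x)))) +
      (((Module.finrank ℝ E : ℝ) / 2 - 1) * (∫ x, φ x * ‖U s x‖ ^ 2) +
        (1 / 2) * ∫ x, fderiv ℝ φ x x * ‖U s x‖ ^ 2)) volume s₀ s₁ :=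
    ((cF.add cD).mono hI').intervalIntegrable
  have iG : IntervalIntegrable (fun s => ∫ x, frobeniusNormSq (fderiv ℝ (U s) x) * φ x)
      volume s₀ s₁ := (cG.mono hI').intervalIntegrable
  -- fundamental theorem of calculus
  have hFTC := intervalIntegral.integral_eq_sub_of_hasDerivAt
    (fun s hs' => h.hasDerivAt_integral_cutoff_norm_sq hS hφ hφc (hI' hs')) iT
  -- the slice balance inside the time integral
  have hslice : ∫ s in s₀..s₁, ∫ x, φ x * (2 * ⟪U s x, timeDerivWithin S U s x⟫) =
      (∫ s in s₀..s₁, ((∫ x, (ν * ((Δ φ) x * ‖U s x‖ ^ 2) +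
        fderiv ℝ φ x (U s x) * ‖U s x‖ ^ 2 + 2 * (P s x * fderiv ℝ φ x (U s x)))) +
        (((Module.finrank ℝ E : ℝ) / 2 - 1) * (∫ x, φ x * ‖U s x‖ ^ 2) +
          (1 / 2) * ∫ x, fderiv ℝ φ x x * ‖U s x‖ ^ 2))) -
      2 * ν * ∫ s in s₀..s₁, ∫ x, frobeniusNormSq (fderiv ℝ (U s) x) * φ x := by
    rw [← intervalIntegral.integral_const_mul, ← intervalIntegral.integral_sub iF (iG.const_mul _)]
    refine intervalIntegral.integral_congr fun s hs' => ?_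
    have := h.integral_energy_flux_cutoff hS hφ hφc (hI' hs')
    linarith
  rw [hslice] at hFTC
  linarith

/-! ### The time-periodic (discretely self-similar) form -/

/-- **The energy identity of a TIME-PERIODIC backward Leray solution over one period**: if
`(U, P)` solves the backward Leray system on all of `ℝ` and `U(s + L) = U(s)` for all `s`
(`L ≥ 0`; the similarity profile of a `λ`-DSS ancient Navier–Stokes solution is `2 log λ`-periodic,
Chae–Wolf 2017 §4), then for every `φ ∈ C_c^∞` and every `s₀`,
`2ν ∫_{s₀}^{s₀+L}∫ φ|∇U|² = ∫_{s₀}^{s₀+L} [∫(νΔφ|U|² + Dφ(U)|U|² + 2PDφ(U)) + ((d/2−1)∫φ|U|² + ½∫(y·∇φ)|U|²)]`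
— over a period, the localised dissipation is paid for exactly by the scaling source, the diffusive
flux and the cubic/pressure flux through the cut-off. [cite: ChaeWolf2017RemovingDSS, §4] -/
theorem IsBackwardLeraySolutionOn.period_energy_identity_cutoff
    (h : IsBackwardLeraySolutionOn (univ : Set ℝ) ν U P) {L : ℝ} (hL : 0 ≤ L)
    (hper : ∀ s x, U (s + L) x = U s x) {φ : E → ℝ} (hφ : ContDiff ℝ ∞ φ)
    (hφc : HasCompactSupport φ) (s₀ : ℝ) :
    2 * ν * ∫ s in s₀..(s₀ + L), ∫ x, frobeniusNormSq (fderiv ℝ (U s) x) * φ x =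
      ∫ s in s₀..(s₀ + L), ((∫ x, (ν * ((Δ φ) x * ‖U s x‖ ^ 2) +
        fderiv ℝ φ x (U s x) * ‖U s x‖ ^ 2 + 2 * (P s x * fderiv ℝ φ x (U s x)))) +
        (((Module.finrank ℝ E : ℝ) / 2 - 1) * (∫ x, φ x * ‖U s x‖ ^ 2) +
          (1 / 2) * ∫ x, fderiv ℝ φ x x * ‖U s x‖ ^ 2)) := by
  have hid := h.local_energy_identity_cutoff isOpen_univ hφ hφc (s₀ := s₀) (s₁ := s₀ + L)
    (by linarith) (subset_univ _)
  have hbd : (∫ x, φ x * ‖U (s₀ + L) x‖ ^ 2) = ∫ x, φ x * ‖U s₀ x‖ ^ 2 := by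
    refine integral_congr_ae (Eventually.of_forall fun x => ?_)
    simp only [hper s₀ x]
  rw [hbd, sub_self, zero_add] at hid
  exact hid

end Literature.Analysis.FluidPDE

end
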